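/-
Copyright (c) 2026. All rights reserved.
Released under Apache 2.0 license as described in the file LICENSE.
-/
import Literature.Probability.FitznerVanDerHofstad2017.NobleBoundsNMidStar
import Literature.Probability.FitznerVanDerHofstad2017.NobleBoundsNMidSOpen
import Literature.Probability.FitznerVanDerHofstad2017.NobleBoundsNMidF1
import HarnessLib

/-!
# NoBLE N-bounds — the ★-cells `(a, 0, ★)` (off and on the pin) and `(0, 1, ★)` of a middle junction (upper level closed)

Completion of the ★-column begun in `NobleBoundsNMidStar` (inner classes `1, 2`): a SPECIAL successor junction (level `k + 1` closed, end = the pin `u_{k+1}`), inner class `c = 0`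
(`t_k = z_k`; off the pin `t_k ≠ u_{k+1}` the `c = 0` summand of the first term of (5.4) pays, on the pin
`t_k = z_k = u_{k+1}` — allowed by the closed canonical clause — the second term `A'^{κ,a,0}(u,w,u′,t)` does) for every lower exit class `a` (primed entry letter for `a = 0`), resp. the cell `(0, 1, ★)` (`w_k = u_k`,
`(t_k, z_k)` an open bond of `ω_{k+1}`) left aside by `NobleBoundsNMidStar`.  Targets: the `c`-summands
`A^{(′)κ,a,0,*}(u,w,t,t) · A^{0,0}(t,t,u′,u′)` and `A^{κ,0,1,*}(u,u,t,z) · A^{1,0}(t,z,u′,u′)` of the first term of the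
pointwise (5.4) in the closed section (`w′ := u_{k+1}`).  Twins of `nonempty_jPkg_midS_zero_zero_zero'`,
`nonempty_jPkg_midS_zero_zero` and `nonempty_jPkg_midS_zero_one_zero` over the closed-level readings (`NobleBoundsNClosedU`): the grouping `glMidS12`
and its letters are reused, the activity / connection facts of the upper level come from `jClosedU_act_up_iff` /
`JFacts.conn_closedU` (slots `0`–`3`; the exit leg `4` is inactive on a closed level).
[cite: FitznerVanDerHofstad2017, §6.1 (6.4), "Case a = 0", "Case b = 0 / b = 1" (arXiv:1506.07977v2 pp. 58–59); §5.1 (5.4) (p. 48); (4.58), (4.62) (p. 41); App. B (pp. 74–75)]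
-/

noncomputable section

namespace Literature.Probability.FitznerVanDerHofstad2017

open Literature.Barriers.CriticalPhenomena Literature.Probability.Percolation
open Literature.Probability.LatticeModels Literature.Combinatorics.SimpleGraph _root_.SimpleGraph
open _root_.MeasureTheory
open Literature.Probability.FitznerVanDerHofstad2017.NobleBlocks
open Literature.Probability.FitznerVanDerHofstad2017.NobleBlocks.LenIdx
open scoped ENNReal

variable {d : ℕ}

section Grouping

variable (M : ℕ) (x : Site d) (b : Fin (M + 2) → Site d × Site d) (w t z : Fin (M + 2) → Site d)
  (a : Fin (M + 2) → Fin 3 ⊕ Unit) (τ : Fin (M + 1) → Bool × Fin 3)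

/-- **The grouping `glMidS12` obeys the (4.65) rule over a closed upper level**: its only cross-level letter joins
lower lines with the entry slots `0, 1`. [cite: FitznerVanDerHofstad2017, §4.4 (4.65) (arXiv:1506.07977v2 p. 43); (4.62) (p. 41)] -/
theorem glMidS12_entry_closedU (i : Fin (M + 1)) {u₀ : Unit} (ha' : a i.succ = Sum.inr u₀)
    (j j' : Fin 6) (hg : glMidS12 (.lo j) = glMidS12 (.up j')) :
    IsEntry (pieceViews M x b w t z a τ i.castSucc.succ).kd j' := by
  rw [pieceViews_mid_kd, ha']
  show (j' : ℕ) < 2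
  fin_cases j' <;> simp [glMidS12] at hg ⊢

/-- **The grouping `glMidS0` (inner class `0`) obeys the (4.65) rule over a closed upper level**: its only
cross-level letter joins lower lines with the entry slot `0`. [cite: FitznerVanDerHofstad2017, §4.4 (4.65) (arXiv:1506.07977v2 p. 43); (4.62) (p. 41)] -/
theorem glMidS0_entry_closedU (i : Fin (M + 1)) {u₀ : Unit} (ha' : a i.succ = Sum.inr u₀)
    (j j' : Fin 6) (hg : glMidS0 (.lo j) = glMidS0 (.up j')) :
    IsEntry (pieceViews M x b w t z a τ i.castSucc.succ).kd j' := by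
  rw [pieceViews_mid_kd, ha']
  show (j' : ℕ) < 2
  fin_cases j' <;> simp [glMidS0] at hg ⊢

end Grouping

section Letter

variable (p : unitInterval) (M : ℕ) (x : Site d) (b : Fin (M + 2) → Site d × Site d) (w t z : Fin (M + 2) → Site d)
  (a : Fin (M + 2) → Fin 3 ⊕ Unit) (τ : Fin (M + 1) → Bool × Fin 3)

/-- **Four-line reading of the letter `xb`** under `glMidS12` over a closed upper level: bond (level `k`),
`v → t`, `t → z` (level `k + 1`), exit line (level `k`). [cite: FitznerVanDerHofstad2017, §4.2 (4.18) (arXiv:1506.07977v2 p. 35); §6.1 (6.4) (p. 58); (4.62) (p. 41)] -/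
theorem junF_closedU12_xb_le₄ (i i₀ : Fin (M + 1)) (hk : i₀.succ = i.castSucc)
    {a₀ : Fin 3} (ha : a i.castSucc = Sum.inl a₀) {u₀ : Unit} (ha' : a i.succ = Sum.inr u₀)
    (EB E0 E1 E2 E3 E4 X5 : Set (BondConfig (Site d))) :
    junF p M x b w t z a τ i.castSucc glMidS12 true false (midEv EB E0 E1 E2 E3 E4 X5) .xb ≤
      piPerc d p 2 (genDisjOcc ![EB, E0, E1, X5] ![0, 1, 1, 0]) := by
  refine junF_le_of_lines p M x b w t z a τ i.castSucc glMidS12 true false _ JIdx.xb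
    ![JIdx.xb, .up 0, .up 1, .lo 5] (by decide) (fun m => ?_) ![0, 1, 1, 0] (fun m => by fin_cases m <;> rfl)
    ![EB, E0, E1, X5] (by funext m; fin_cases m <;> rfl)
  fin_cases m
  · exact ⟨rfl, rfl⟩
  · exact ⟨(jClosedU_act_up_iff M x b w t z a τ i ha' true false 0).2 (by decide), rfl⟩
  · exact ⟨(jClosedU_act_up_iff M x b w t z a τ i ha' true false 1).2 (by decide), rfl⟩
  · exact ⟨(jMidOpen_act_lo_iff M x b w t z a τ i i₀ hk ha true false 5).2 rfl, rfl⟩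

/-- **Three-line reading of the letter `xb`, sausage slot dropped** (`c = 0`: `t = z`), closed upper level.
[cite: FitznerVanDerHofstad2017, §4.2 (4.18) (arXiv:1506.07977v2 p. 35); §6.1 (6.4) (p. 58); (4.62) (p. 41)] -/
theorem junF_closedU12_xb_le₃ (i i₀ : Fin (M + 1)) (hk : i₀.succ = i.castSucc)
    {a₀ : Fin 3} (ha : a i.castSucc = Sum.inl a₀) {u₀ : Unit} (ha' : a i.succ = Sum.inr u₀)
    (EB E0 E1 E2 E3 E4 X5 : Set (BondConfig (Site d))) :
    junF p M x b w t z a τ i.castSucc glMidS12 true false (midEv EB E0 E1 E2 E3 E4 X5) .xb ≤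
      piPerc d p 2 (genDisjOcc ![EB, E0, X5] ![0, 1, 0]) := by
  refine junF_le_of_lines p M x b w t z a τ i.castSucc glMidS12 true false _ JIdx.xb
    ![JIdx.xb, .up 0, .lo 5] (by decide) (fun m => ?_) ![0, 1, 0] (fun m => by fin_cases m <;> rfl)
    ![EB, E0, X5] (by funext m; fin_cases m <;> rfl)
  fin_cases m
  · exact ⟨rfl, rfl⟩
  · exact ⟨(jClosedU_act_up_iff M x b w t z a τ i ha' true false 0).2 (by decide), rfl⟩
  · exact ⟨(jMidOpen_act_lo_iff M x b w t z a τ i i₀ hk ha true false 5).2 rfl, rfl⟩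

/-- **Three-line reading of the letter `xb`, entry slot dropped** (sub-row `x = e` of row `(0,1)`: `t = v`),
closed upper level. [cite: FitznerVanDerHofstad2017, §4.2 (4.18) (arXiv:1506.07977v2 p. 35); §6.1 (6.4) (p. 58); (4.62) (p. 41)] -/
theorem junF_closedU12_xb_le₃' (i i₀ : Fin (M + 1)) (hk : i₀.succ = i.castSucc)
    {a₀ : Fin 3} (ha : a i.castSucc = Sum.inl a₀) {u₀ : Unit} (ha' : a i.succ = Sum.inr u₀)
    (EB E0 E1 E2 E3 E4 X5 : Set (BondConfig (Site d))) :
    junF p M x b w t z a τ i.castSucc glMidS12 true false (midEv EB E0 E1 E2 E3 E4 X5) .xb ≤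
      piPerc d p 2 (genDisjOcc ![EB, E1, X5] ![0, 1, 0]) := by
  refine junF_le_of_lines p M x b w t z a τ i.castSucc glMidS12 true false _ JIdx.xb
    ![JIdx.xb, .up 1, .lo 5] (by decide) (fun m => ?_) ![0, 1, 0] (fun m => by fin_cases m <;> rfl)
    ![EB, E1, X5] (by funext m; fin_cases m <;> rfl)
  fin_cases m
  · exact ⟨rfl, rfl⟩
  · exact ⟨(jClosedU_act_up_iff M x b w t z a τ i ha' true false 1).2 (by decide), rfl⟩
  · exact ⟨(jMidOpen_act_lo_iff M x b w t z a τ i i₀ hk ha true false 5).2 rfl, rfl⟩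

/-- **Two-line reading of the letter `up 2`** under `glMidS12` over a closed upper level (no exit leg):
`t → u′` (slot 2), `u′ → z` (slot 3, read backwards), both on level `k + 1`.
[cite: FitznerVanDerHofstad2017, §4.2 (4.16) (arXiv:1506.07977v2 p. 36); §6.1 (6.4) (p. 58); (4.58), (4.62) (p. 41)] -/
theorem junF_closedU12_up_le₂ (i : Fin (M + 1)) {u₀ : Unit} (ha' : a i.succ = Sum.inr u₀)
    (EB E0 E1 E2 E3 E4 X5 : Set (BondConfig (Site d))) :
    junF p M x b w t z a τ i.castSucc glMidS12 true false (midEv EB E0 E1 E2 E3 E4 X5) (.up 2) ≤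
      piPerc d p 2 (genDisjOcc ![E2, E3] ![1, 1]) := by
  refine junF_le_of_lines p M x b w t z a τ i.castSucc glMidS12 true false _ (JIdx.up 2)
    ![JIdx.up 2, .up 3] (by decide) (fun m => ?_) ![1, 1] (fun m => by fin_cases m <;> rfl)
    ![E2, E3] (by funext m; fin_cases m <;> rfl)
  fin_cases m
  · exact ⟨(jClosedU_act_up_iff M x b w t z a τ i ha' true false 2).2 (by decide), rfl⟩
  · exact ⟨(jClosedU_act_up_iff M x b w t z a τ i ha' true false 3).2 (by decide), rfl⟩

/-- **Three-line reading of the term-2 letter over a closed upper level** (on the pin `t_k = u_{k+1}`): bond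
(level `k`), `v → t` (slot `0` of level `k + 1`), exit line (level `k`); the sausage and pin slots are loops.
[cite: FitznerVanDerHofstad2017, §4.2 (4.18) (arXiv:1506.07977v2 p. 35); §6.1 (6.4) (p. 58); (4.58), (4.62) (p. 41)] -/
theorem junF_closedU1_xb_le₃ (i i₀ : Fin (M + 1)) (hk : i₀.succ = i.castSucc) {a₀ : Fin 3}
    (ha : a i.castSucc = Sum.inl a₀) {u₀ : Unit} (ha' : a i.succ = Sum.inr u₀) (EB E0 E1 X5 : Set (BondConfig (Site d))) :
    junF p M x b w t z a τ i.castSucc glMidS1 true false (midF1Ev EB E0 E1 X5) .xb ≤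
      piPerc d p 2 (genDisjOcc ![EB, E0, X5] ![0, 1, 0]) := by
  refine junF_le_of_lines p M x b w t z a τ i.castSucc glMidS1 true false _ JIdx.xb
    ![JIdx.xb, .up 0, .lo 5] (by decide) (fun m => ?_) ![0, 1, 0] (fun m => by fin_cases m <;> rfl)
    ![EB, E0, X5] (by funext m; fin_cases m <;> rfl)
  fin_cases m
  · exact ⟨rfl, rfl⟩
  · exact ⟨(jClosedU_act_up_iff M x b w t z a τ i ha' true false 0).2 (by decide), rfl⟩
  · exact ⟨(jMidOpen_act_lo_iff M x b w t z a τ i i₀ hk ha true false 5).2 rfl, rfl⟩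

variable (c : Fin 3 ⊕ Unit)

/-- **The core of the ★-packages under `glMidS12`**: finitary events `E0 ⊇` the witness of `v → t`, `E1 ⊇` the
witness of `t → z`, `X5 ⊇` the exit witness of level `k`, `E2, E3 ⊇` the witnesses of `t → u′`, `z → u′` (on the
piece), and bounds of the two letters `xb` and `up 2` give a package with target the product.
[cite: FitznerVanDerHofstad2017, §6.1 (6.4) (arXiv:1506.07977v2 p. 58); §4.4 (4.57)–(4.62), (4.65) (pp. 41, 43)] -/
theorem nonempty_jPkg_closedU12_core (i i₀ : Fin (M + 1)) (hk : i₀.succ = i.castSucc) (κ : Fin d × Bool)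
    (hb : (b i.castSucc).2 = (b i.castSucc).1 + stepVec κ) {a₀ : Fin 3}
    (ha : a i.castSucc = Sum.inl a₀) {u₀ : Unit} (ha' : a i.succ = Sum.inr u₀)
    (E0 E1 E2 E3 X5 : Set (BondConfig (Site d)))
    (h0 : IsFinitary E0) (h1 : IsFinitary E1) (h2 : IsFinitary E2) (h3 : IsFinitary E3) (h5 : IsFinitary X5)
    (hmem : ∀ ω K₀, JFacts M x b w t z a c τ ω K₀ →
      K₀ i.castSucc.succ 0 ∈ E0 ∧ K₀ i.castSucc.succ 1 ∈ E1 ∧ K₀ i.castSucc.succ 2 ∈ E2 ∧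
        K₀ i.castSucc.succ 3 ∈ E3 ∧ K₀ i.castSucc.castSucc 5 ∈ X5)
    {T₁ T₂ : ℝ≥0∞}
    (hrow₁ : junF p M x b w t z a τ i.castSucc glMidS12 true false
      (midEv (event (eq 1) (b i.castSucc).1 (b i.castSucc).2) E0 E1 E2 E3 Set.univ X5) .xb ≤ T₁)
    (hrow₂ : junF p M x b w t z a τ i.castSucc glMidS12 true false
      (midEv (event (eq 1) (b i.castSucc).1 (b i.castSucc).2) E0 E1 E2 E3 Set.univ X5) (.up 2) ≤ T₂) :
    Nonempty (JPkg p (jctx M x b w t z a τ i.castSucc) (JFacts M x b w t z a c τ) (T₁ * T₂)) := by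
  have huv : (b i.castSucc).1 ≠ (b i.castSucc).2 := by
    rw [hb]; exact (zdGraph_adj_iff_stepVec _ _ |>.2 ⟨κ, rfl⟩).ne
  refine nonempty_jPkg_of_joint p i.castSucc glMidS12 true
    (midEv (event (eq 1) (b i.castSucc).1 (b i.castSucc).2) E0 E1 E2 E3 Set.univ X5)
    (isFinitary_midEv _ _ _ _ _ _ _ (isFinitary_event _ _ _) h0 h1 h2 h3 isFinitary_univ h5)
    (fun _ => by rw [midEv_xb]; exact singleton_mem_event_eq_one huv)
    (fun j j' _ _ hg => glMidS12_entry_closedU M x b w t z a τ i ha' j j' hg)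
    (fun ω K₀ hF => ⟨fun j hj => ?_, fun j hj => ?_⟩) ?_
  · -- the exit witness of level `k`
    obtain rfl := (jMidOpen_act_lo_iff M x b w t z a τ i i₀ hk ha true false j).1 hj
    rw [midEv_lo_five]
    exact (hmem ω K₀ hF).2.2.2.2
  · -- the witnesses of level `k + 1` (slots `0`–`3`)
    have hj4 : (j : ℕ) < 4 := (jClosedU_act_up_iff M x b w t z a τ i ha' true false j).1 hj
    have hj5 : j ≠ 5 := by intro h; rw [h] at hj4; exact absurd hj4 (by decide)
    obtain ⟨m0, m1, m2, m3, -⟩ := hmem ω K₀ hF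
    exact mem_midEv_up _ _ _ _ _ _ _ m0 m1 m2 m3 (Set.mem_univ _) j hj5
  · -- two genuine letters
    exact (prod_junF_le₂ p M x b w t z a τ i.castSucc glMidS12 true false _
      (show JIdx.xb ≠ JIdx.up 2 by decide)).trans (mul_le_mul' hrow₁ hrow₂)

/-- **The core of the term-2 package over a closed upper level** (grouping `glMidS1`): finitary events `E0 ⊇` the
witness of `v → t`, `X5 ⊇` the exit witness of level `k` (on the piece), and a bound of the single genuine letter
`xb` = {bond, `v → t`, exit} by the target give a package; the letter `up 2` (slots `2, 3`) is bounded by `1`.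
[cite: FitznerVanDerHofstad2017, §6.1 (6.4) (arXiv:1506.07977v2 p. 58); §5.1 (5.4) second term (p. 48); §4.4 (4.57)–(4.62), (4.65) (pp. 41, 43)] -/
theorem nonempty_jPkg_closedU1_core (i i₀ : Fin (M + 1)) (hk : i₀.succ = i.castSucc) (κ : Fin d × Bool)
    (hb : (b i.castSucc).2 = (b i.castSucc).1 + stepVec κ) {a₀ : Fin 3}
    (ha : a i.castSucc = Sum.inl a₀) {u₀ : Unit} (ha' : a i.succ = Sum.inr u₀) (E0 X5 : Set (BondConfig (Site d)))
    (h0 : IsFinitary E0) (h5 : IsFinitary X5)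
    (hmem : ∀ ω K₀, JFacts M x b w t z a c τ ω K₀ → K₀ i.castSucc.succ 0 ∈ E0 ∧ K₀ i.castSucc.castSucc 5 ∈ X5)
    {tgt : ℝ≥0∞}
    (hrow : junF p M x b w t z a τ i.castSucc glMidS1 true false
      (midF1Ev (event (eq 1) (b i.castSucc).1 (b i.castSucc).2) E0 Set.univ X5) .xb ≤ tgt) :
    Nonempty (JPkg p (jctx M x b w t z a τ i.castSucc) (JFacts M x b w t z a c τ) tgt) := by
  have huv : (b i.castSucc).1 ≠ (b i.castSucc).2 := by
    rw [hb]; exact (zdGraph_adj_iff_stepVec _ _ |>.2 ⟨κ, rfl⟩).ne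
  refine nonempty_jPkg_of_joint p i.castSucc glMidS1 true
    (midF1Ev (event (eq 1) (b i.castSucc).1 (b i.castSucc).2) E0 Set.univ X5)
    (isFinitary_midEv _ _ _ _ _ _ _ (isFinitary_event _ _ _) h0 isFinitary_univ isFinitary_univ isFinitary_univ
      isFinitary_univ h5)
    (fun _ => by rw [midF1Ev, midEv_xb]; exact singleton_mem_event_eq_one huv)
    (fun j j' _ _ hg => glMidS1_entry_closedU M x b w t z a τ i ha' j j' hg)
    (fun ω K₀ hF => ⟨fun j hj => ?_, fun j hj => ?_⟩) ?_
  · -- the exit witness of level `k`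
    obtain rfl := (jMidOpen_act_lo_iff M x b w t z a τ i i₀ hk ha true false j).1 hj
    rw [midF1Ev, midEv_lo_five]
    exact (hmem ω K₀ hF).2
  · -- the witnesses of level `k + 1` (slots `0`–`3`)
    have hj4 : (j : ℕ) < 4 := (jClosedU_act_up_iff M x b w t z a τ i ha' true false j).1 hj
    have hj5 : j ≠ 5 := by intro h; rw [h] at hj4; exact absurd hj4 (by decide)
    exact mem_midEv_up _ _ _ _ _ _ _ (hmem ω K₀ hF).1 (Set.mem_univ _) (Set.mem_univ _) (Set.mem_univ _)
      (Set.mem_univ _) j hj5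
  · -- one genuine letter
    refine (prod_junF_le₂ p M x b w t z a τ i.castSucc glMidS1 true false _
      (show JIdx.xb ≠ JIdx.up 2 by decide)).trans ?_
    refine (mul_le_mul' hrow (junF_le_one p M x b w t z a τ i.castSucc glMidS1 true false _ _)).trans ?_
    rw [mul_one]

end Letter

section Packages

variable (p : unitInterval) (M : ℕ) (x : Site d) (b : Fin (M + 2) → Site d × Site d) (w t z : Fin (M + 2) → Site d)
  (a : Fin (M + 2) → Fin 3 ⊕ Unit) (c : Fin 3 ⊕ Unit) (τ : Fin (M + 1) → Bool × Fin 3)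

/-- **Cell `(0, 0, ★)` off the pin**, primed entry letter: for a middle junction `k = i₀ + 1 ≤ M` with lower exit
class `0` (`w_k = u_k`), inner class `0` (`t_k = z_k`) and a special successor junction, in the regime
`t_k ≠ u_{k+1}`, a package with target `A'^{κ,0,0,*}(u_k,w_k,t_k,z_k) · A^{0,0}(t_k,z_k,u_{k+1},u_{k+1})` = the
`c = 0` summand of the first term of (5.4) in the closed section.  The entry letter is the §6.1 triangle
`T_{1̲,1,1}(e, t−u, 0)`, the exit letter the double connection `ℙ(t ⇔ u′)` (`t ≠ u′`).  (On the pin,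
`t_k = z_k = u_{k+1}`, this summand vanishes and the second term of (5.4) pays: `nonempty_jPkg_closedU_pin`.)
[cite: FitznerVanDerHofstad2017, §6.1 (6.4), "Case a = 0 and b = 0" (arXiv:1506.07977v2 pp. 58–59); §5.1 (5.4) (p. 48); (4.58), (4.62) (p. 41); App. B (pp. 74–75)] -/
theorem nonempty_jPkg_closedU_zero_zero_zero' (i i₀ : Fin (M + 1)) (hk : i₀.succ = i.castSucc) (κ : Fin d × Bool)
    (hb : (b i.castSucc).2 = (b i.castSucc).1 + stepVec κ) (hc0 : (τ i).2 = 0)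
    (ha : a i.castSucc = Sum.inl 0) {u₀ : Unit} (ha' : a i.succ = Sum.inr u₀)
    (hty : t i.castSucc ≠ (b i.succ).1) :
    Nonempty (JPkg p (jctx M x b w t z a τ i.castSucc) (JFacts M x b w t z a c τ)
      (blockAiotaSt' (Letters.perc d p) κ 0 0 (b i.castSucc).1 (w i.castSucc) (t i.castSucc) (z i.castSucc) *
        blockA (Letters.perc d p) 0 0 (t i.castSucc) (z i.castSucc) (b i.succ).1 (b i.succ).1)) := by
  -- degenerate parameters: the piece is empty
  by_cases hP : z i.castSucc = t i.castSucc ∧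
      (b i.castSucc).1 ≠ t i.castSucc ∧ (b i.castSucc).2 ≠ z i.castSucc ∧ w i.castSucc = (b i.castSucc).1
  swap
  · refine ⟨JPkg.vacuous p _ _ (fun ω K₀ hF => hP ?_) _⟩
    have hv := hF.vac_closedU i ha'
    exact ⟨(hF.t_eq_z_of_innerClass_zero i hc0).symm, fun h => hv (by simp [h]), hF.v_ne_z_of_open i i₀ hk ha,
      hF.w_eq_of_exitClass_zero i.castSucc ha⟩
  obtain ⟨hzt, hut, hvz, hwu⟩ := hP
  have hvt : (b i.castSucc).2 ≠ t i.castSucc := by rw [← hzt]; exact hvz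
  rw [hzt, hwu]
  have h := nonempty_jPkg_closedU12_core p M x b w t z a τ c i i₀ hk κ hb ha ha'
    (event (ge 1) (b i.castSucc).2 (t i.castSucc)) Set.univ (event (ge 0) (t i.castSucc) (b i.succ).1)
    (event (ge 0) (t i.castSucc) (b i.succ).1) (event (ge 1) (t i.castSucc) (b i.castSucc).1)
    (isFinitary_event _ _ _) isFinitary_univ (isFinitary_event _ _ _) (isFinitary_event _ _ _)
    (isFinitary_event _ _ _) (fun ω K₀ hF => ?_)
    (T₁ := blockAiotaSt' (Letters.perc d p) κ 0 0 (b i.castSucc).1 (b i.castSucc).1 (t i.castSucc) (t i.castSucc))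
    (T₂ := blockA (Letters.perc d p) 0 0 (t i.castSucc) (t i.castSucc) (b i.succ).1 (b i.succ).1) ?_ ?_
  · exact h
  · obtain ⟨h0, -, h2, h3⟩ := hF.conn_closedU i ha'
    rw [hzt] at h3
    have h5 := hF.conn_exit i i₀ hk ha
    rw [hzt, hwu] at h5
    refine ⟨?_, Set.mem_univ _, ?_, ?_, ?_⟩
    · rw [event_ge]; exact mem_openConnGe_one_of_ne h0 hvt
    · rw [event_ge]; exact mem_openConnGe_zero_of_mem h2
    · rw [event_ge]; exact mem_openConnGe_zero_of_mem h3
    · rw [event_comm, event_ge]; exact mem_openConnGe_one_of_ne h5 hut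
  · refine (junF_closedU12_xb_le₃ p M x b w t z a τ i i₀ hk ha ha' _ _ _ _ _ _ _).trans ?_
    exact piPerc_midS_zero_zero_le_blockAiotaSt' p hb hvt.symm (fun h => hut h.symm) _
  · refine (junF_closedU12_up_le₂ p M x b w t z a τ i ha' _ _ _ _ _ _ _).trans ?_
    exact piPerc_midS_zero_zero_le_blockA p hty _ rfl

/-- **Cell `(0, 1, ★)`** of a middle junction `k = i₀ + 1 ≤ M`: a package with target
`A^{κ,0,1,*}(u_k,w_k,t_k,z_k) · A^{1,0}(t_k,z_k,u_{k+1},u_{k+1})` = the `c = 1` summand of the first term of (5.4)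
in the closed section.  Exit class `0` below (`w_k = u_k`), inner class `1` (the sausage line of level `k + 1` is the
open bond `{t ←1̲→ z}` itself), closed level above (`t, z ≠ u′` by the canonical clause: exit letter
`2dD(z−t) 𝓑_{1,1}(u′−t, z−t)`); the two-summand row `(0,1)` of `A^{ι,a,b,*}` is met in its sub-rows `t = b̄_k`
(triangle, exit leg of length `≥ 2` by parity) and `t ≠ b̄_k` (square), as in the open case.
[cite: FitznerVanDerHofstad2017, §6.1 (6.4), "Case a = 0", "Case b = 1" (arXiv:1506.07977v2 pp. 58–59); §5.1 (5.4) (p. 48); (4.58), (4.62) (p. 41); App. B (pp. 74–75)] -/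
theorem nonempty_jPkg_closedU_zero_one (i i₀ : Fin (M + 1)) (hk : i₀.succ = i.castSucc) (κ : Fin d × Bool)
    (hb : (b i.castSucc).2 = (b i.castSucc).1 + stepVec κ) (hc1 : (τ i).2 = 1)
    (ha : a i.castSucc = Sum.inl 0) {u₀ : Unit} (ha' : a i.succ = Sum.inr u₀) :
    Nonempty (JPkg p (jctx M x b w t z a τ i.castSucc) (JFacts M x b w t z a c τ)
      (blockAiotaSt (Letters.perc d p) κ 0 1 (b i.castSucc).1 (w i.castSucc) (t i.castSucc) (z i.castSucc) *
        blockA (Letters.perc d p) 1 0 (t i.castSucc) (z i.castSucc) (b i.succ).1 (b i.succ).1)) := by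
  -- degenerate parameters: the piece is empty
  by_cases hP : (zdGraph d).Adj (t i.castSucc) (z i.castSucc) ∧
      t i.castSucc ≠ (b i.succ).1 ∧ z i.castSucc ≠ (b i.succ).1 ∧ (b i.castSucc).1 ≠ z i.castSucc ∧
      w i.castSucc = (b i.castSucc).1
  swap
  · refine ⟨JPkg.vacuous p _ _ (fun ω K₀ hF => hP ?_) _⟩
    have hv := hF.vac_closedU i ha'
    have hadj := (hF.innerClass_one i hc1).2.2
    have hne := hF.ne_pin_closedU i ha' hadj.ne
    exact ⟨hadj, hne.2, hne.1, fun h => hv (by simp [h]), hF.w_eq_of_exitClass_zero i.castSucc ha⟩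
  obtain ⟨hadj, hty, hzy, huz, hwu⟩ := hP
  have htz : t i.castSucc ≠ z i.castSucc := hadj.ne
  obtain ⟨κ', hκ'⟩ := (zdGraph_adj_iff_stepVec _ _).1 hadj
  -- the open sausage bond is its own witness
  have hbond : ∀ ω K₀, JFacts M x b w t z a c τ ω K₀ →
      K₀ i.castSucc.succ 1 ∈ (event (eq 1) (t i.castSucc) (z i.castSucc) : Set (BondConfig (Site d))) := by
    intro ω K₀ hF
    rw [hF.tz_witness_closedU i ha' htz (hF.innerClass_one i hc1).2.1]
    exact singleton_mem_event_eq_one htz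
  -- the exit letter `A^{1,0}`: `t → u′`, `u′ → z`
  have hexit : ∀ ω K₀, JFacts M x b w t z a c τ ω K₀ →
      K₀ i.castSucc.succ 2 ∈ (event (ge 1) (t i.castSucc) (b i.succ).1 : Set (BondConfig (Site d))) ∧
        K₀ i.castSucc.succ 3 ∈ (event (ge 1) (b i.succ).1 (z i.castSucc) : Set (BondConfig (Site d))) := by
    intro ω K₀ hF
    obtain ⟨-, -, h2, h3⟩ := hF.conn_closedU i ha'
    refine ⟨?_, ?_⟩
    · rw [event_ge]; exact mem_openConnGe_one_of_ne h2 hty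
    · rw [event_comm, event_ge]; exact mem_openConnGe_one_of_ne h3 hzy
  rw [hwu]
  by_cases hx : t i.castSucc = (b i.castSucc).2
  · -- sub-row `x = e`: triangle, exit leg of length `≥ 2` by parity
    have h := nonempty_jPkg_closedU12_core p M x b w t z a τ c i i₀ hk κ hb ha ha' Set.univ
      (event (eq 1) (t i.castSucc) (z i.castSucc)) (event (ge 1) (t i.castSucc) (b i.succ).1)
      (event (ge 1) (b i.succ).1 (z i.castSucc)) (event (ge 2) (z i.castSucc) (b i.castSucc).1)
      isFinitary_univ (isFinitary_event _ _ _) (isFinitary_event _ _ _) (isFinitary_event _ _ _)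
      (isFinitary_event _ _ _) (fun ω K₀ hF => ?_)
      (T₁ := blockAiotaSt (Letters.perc d p) κ 0 1 (b i.castSucc).1 (b i.castSucc).1 (t i.castSucc) (z i.castSucc))
      (T₂ := blockA (Letters.perc d p) 1 0 (t i.castSucc) (z i.castSucc) (b i.succ).1 (b i.succ).1) ?_ ?_
    · exact h
    · have h5 := hF.conn_exit i i₀ hk ha
      rw [hwu] at h5
      have hadj' : (zdGraph d).Adj (b i.castSucc).1 (b i.castSucc).2 := (zdGraph_adj_iff_stepVec _ _).2 ⟨κ, hb⟩
      have hna : ¬ (zdGraph d).Adj (b i.castSucc).1 (z i.castSucc) :=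
        not_adj_of_adj_adj hadj' (by rw [← hx]; exact hadj)
      refine ⟨Set.mem_univ _, hbond ω K₀ hF, (hexit ω K₀ hF).1, (hexit ω K₀ hF).2, ?_⟩
      rw [event_comm, event_ge]
      refine mem_openConnGe_two_of_notMem h5 huz fun hm => hna ?_
      exact (SimpleGraph.mem_edgeSet _).1 (hF.lattice _ (hF.witness_subset _ 5 hm))
    · refine (junF_closedU12_xb_le₃' p M x b w t z a τ i i₀ hk ha ha' _ _ _ _ _ _ _).trans ?_
      rw [hx]
      exact piPerc_midS_zero_one_e_le_blockAiotaSt p hb (fun h => huz h.symm) _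
    · refine (junF_closedU12_up_le₂ p M x b w t z a τ i ha' _ _ _ _ _ _ _).trans ?_
      exact piPerc_midS_one_zero_le_blockA p hκ' _
  · -- sub-row `x ≠ e`: square
    have h := nonempty_jPkg_closedU12_core p M x b w t z a τ c i i₀ hk κ hb ha ha'
      (event (ge 1) (b i.castSucc).2 (t i.castSucc)) (event (eq 1) (t i.castSucc) (z i.castSucc))
      (event (ge 1) (t i.castSucc) (b i.succ).1) (event (ge 1) (b i.succ).1 (z i.castSucc))
      (event (ge 1) (z i.castSucc) (b i.castSucc).1)
      (isFinitary_event _ _ _) (isFinitary_event _ _ _) (isFinitary_event _ _ _) (isFinitary_event _ _ _)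
      (isFinitary_event _ _ _) (fun ω K₀ hF => ?_)
      (T₁ := blockAiotaSt (Letters.perc d p) κ 0 1 (b i.castSucc).1 (b i.castSucc).1 (t i.castSucc) (z i.castSucc))
      (T₂ := blockA (Letters.perc d p) 1 0 (t i.castSucc) (z i.castSucc) (b i.succ).1 (b i.succ).1) ?_ ?_
    · exact h
    · obtain ⟨h0, -⟩ := hF.conn_closedU i ha'
      have h5 := hF.conn_exit i i₀ hk ha
      rw [hwu] at h5
      refine ⟨?_, hbond ω K₀ hF, (hexit ω K₀ hF).1, (hexit ω K₀ hF).2, ?_⟩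
      · rw [event_ge]; exact mem_openConnGe_one_of_ne h0 (fun h => hx h.symm)
      · rw [event_comm, event_ge]; exact mem_openConnGe_one_of_ne h5 huz
    · refine (junF_closedU12_xb_le₄ p M x b w t z a τ i i₀ hk ha ha' _ _ _ _ _ _ _).trans ?_
      exact piPerc_midS_zero_one_ne_le_blockAiotaSt p hb (fun h => huz h.symm) _
    · refine (junF_closedU12_up_le₂ p M x b w t z a τ i ha' _ _ _ _ _ _ _).trans ?_
      exact piPerc_midS_one_zero_le_blockA p hκ' _

/-- **Cells `(a, 0, ★)` off the pin, `a ∈ {1,2}`**, of a middle junction `k = i₀ + 1 ≤ M`: in the regime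
`t_k ≠ u_{k+1}` a package with target the `c = 0` summand `A^{κ,a,0,*}(u_k,w_k,t_k,z_k) · A^{0,0}(t_k,z_k,u_{k+1},u_{k+1})`
of the first term of (5.4) in the closed section.  Inner class `0` identifies `z_k = t_k`, so the exit line of level
`k` reads `{t ↔ w}` and the entry line `{v ←1→ t}` (`v = b̄_k ≠ z_k`, (4.64)); the two lines `t → u_{k+1}`,
`z → u_{k+1}` of the closed level become the double connection `t ⇔ u_{k+1}` (`t ≠ u_{k+1}`).  (On the pin the
summand vanishes and the second term of (5.4) pays, `nonempty_jPkg_closedU_pin`; `a = 0` is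
`nonempty_jPkg_closedU_zero_zero_zero'`.)
[cite: FitznerVanDerHofstad2017, §6.1 (6.4), "Case a = 1 / a ≥ 2", "Case b = 0" (arXiv:1506.07977v2 pp. 58–59); §5.1 (5.4) (p. 48); (4.58), (4.62) (p. 41); App. B (pp. 74–75); (4.64) (p. 42)] -/
theorem nonempty_jPkg_closedU_zero (i i₀ : Fin (M + 1)) (hk : i₀.succ = i.castSucc) (κ : Fin d × Bool)
    (hb : (b i.castSucc).2 = (b i.castSucc).1 + stepVec κ) (hc0 : (τ i).2 = 0)
    (a₀ : Fin 3) (ha : a i.castSucc = Sum.inl a₀) (ha0 : a₀ ≠ 0) {u₀ : Unit} (ha' : a i.succ = Sum.inr u₀)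
    (hty : t i.castSucc ≠ (b i.succ).1) :
    Nonempty (JPkg p (jctx M x b w t z a τ i.castSucc) (JFacts M x b w t z a c τ)
      (blockAiotaSt (Letters.perc d p) κ a₀ 0 (b i.castSucc).1 (w i.castSucc) (t i.castSucc) (z i.castSucc) *
        blockA (Letters.perc d p) 0 0 (t i.castSucc) (z i.castSucc) (b i.succ).1 (b i.succ).1)) := by
  -- degenerate parameters: the piece is empty
  by_cases hP : z i.castSucc = t i.castSucc ∧
      (b i.castSucc).1 ≠ t i.castSucc ∧ (b i.castSucc).2 ≠ z i.castSucc ∧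
      (a₀ = 1 → (zdGraph d).Adj (b i.castSucc).1 (w i.castSucc))
  swap
  · refine ⟨JPkg.vacuous p _ _ (fun ω K₀ hF => hP ?_) _⟩
    have hv := hF.vac_closedU i ha'
    refine ⟨(hF.t_eq_z_of_innerClass_zero i hc0).symm, fun h => hv (by simp [h]), hF.v_ne_z_of_open i i₀ hk ha,
      fun h1 => (hF.exitClass_one i.castSucc (ha.trans (by rw [h1]))).2.2⟩
  obtain ⟨hzt, hut, hvz, hw1⟩ := hP
  have huv : (b i.castSucc).1 ≠ (b i.castSucc).2 := by
    rw [hb]; exact (zdGraph_adj_iff_stepVec _ _ |>.2 ⟨κ, rfl⟩).ne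
  have hvt : (b i.castSucc).2 ≠ t i.castSucc := by rw [← hzt]; exact hvz
  rw [hzt]
  refine nonempty_jPkg_of_joint p i.castSucc glMidS0 true
    (midEv (event (eq 1) (b i.castSucc).1 (b i.castSucc).2) (event (ge 1) (b i.castSucc).2 (t i.castSucc))
      Set.univ (event (ge 0) (t i.castSucc) (b i.succ).1) (event (ge 0) (t i.castSucc) (b i.succ).1) Set.univ
      (event (ge 0) (t i.castSucc) (w i.castSucc)))
    (isFinitary_midEv _ _ _ _ _ _ _ (isFinitary_event _ _ _) (isFinitary_event _ _ _) isFinitary_univ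
      (isFinitary_event _ _ _) (isFinitary_event _ _ _) isFinitary_univ (isFinitary_event _ _ _))
    (fun _ => by rw [midEv_xb]; exact singleton_mem_event_eq_one huv)
    (fun j j' _ _ hg => glMidS0_entry_closedU M x b w t z a τ i ha' j j' hg)
    (fun ω K₀ hF => ⟨fun j hj => ?_, fun j hj => ?_⟩) ?_
  · -- the exit witness of level `k` (`w → z = t`) lies in the exit-line event
    obtain rfl := (jMidOpen_act_lo_iff M x b w t z a τ i i₀ hk ha true false j).1 hj
    rw [midEv_lo_five]
    have h5 := hF.conn_exit i i₀ hk ha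
    rw [hzt] at h5
    rw [event_comm, event_ge]
    exact mem_openConnGe_zero_of_mem h5
  · -- the witnesses of level `k + 1` (slots `0`–`3`) lie in the upgraded events
    have hj4 : (j : ℕ) < 4 := (jClosedU_act_up_iff M x b w t z a τ i ha' true false j).1 hj
    have hj5 : j ≠ 5 := by intro h; rw [h] at hj4; exact absurd hj4 (by decide)
    obtain ⟨h0, -, h2, h3⟩ := hF.conn_closedU i ha'
    rw [hzt] at h3
    refine mem_midEv_up _ _ _ _ _ _ _ ?_ (Set.mem_univ _) ?_ ?_ (Set.mem_univ _) j hj5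
    · rw [event_ge]; exact mem_openConnGe_one_of_ne h0 hvt
    · rw [event_ge]; exact mem_openConnGe_zero_of_mem h2
    · rw [event_ge]; exact mem_openConnGe_zero_of_mem h3
  · -- the two letters
    refine (prod_junF_le₂ p M x b w t z a τ i.castSucc glMidS0 true false _
      (show JIdx.xb ≠ JIdx.up 2 by decide)).trans (mul_le_mul' ?_ ?_)
    · -- `A^{κ,a,0,*}`: bond, `v → t`, exit of level `k`, on levels `k, k+1, k`
      refine (junF_le_of_lines p M x b w t z a τ i.castSucc glMidS0 true false _ JIdx.xb
        ![JIdx.xb, .up 0, .lo 5] (by decide) (fun m => ?_) ![0, 1, 0] (fun m => by fin_cases m <;> rfl)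
        ![event (eq 1) (b i.castSucc).1 (b i.castSucc).2, event (ge 1) (b i.castSucc).2 (t i.castSucc),
          event (ge 0) (t i.castSucc) (w i.castSucc)]
        (by funext m; fin_cases m <;> rfl)).trans ?_
      · fin_cases m
        · exact ⟨rfl, rfl⟩
        · exact ⟨(jClosedU_act_up_iff M x b w t z a τ i ha' true false 0).2 (by decide), rfl⟩
        · exact ⟨(jMidOpen_act_lo_iff M x b w t z a τ i i₀ hk ha true false 5).2 rfl, rfl⟩
      · obtain h1 | h2 : a₀ = 1 ∨ a₀ = 2 := by
          fin_cases a₀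
          · exact absurd rfl ha0
          · exact Or.inl rfl
          · exact Or.inr rfl
        · subst h1
          obtain ⟨κ', hκ'⟩ := (zdGraph_adj_iff_stepVec _ _).1 (hw1 rfl)
          exact piPerc_midS_one_zero_le_blockAiotaSt p hb hκ' hut.symm _
        · subst h2
          exact piPerc_midS_two_zero_le_blockAiotaSt p hb _
    · -- `A^{0,0}`: the double connection `t ⇔ u′` on level `k + 1`
      refine (junF_le_of_lines p M x b w t z a τ i.castSucc glMidS0 true false _ (JIdx.up 2)
        ![JIdx.up 2, .up 3] (by decide) (fun m => ?_) ![1, 1] (fun m => by fin_cases m <;> rfl)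
        ![event (ge 0) (t i.castSucc) (b i.succ).1, event (ge 0) (t i.castSucc) (b i.succ).1]
        (by funext m; fin_cases m <;> rfl)).trans ?_
      · fin_cases m
        · exact ⟨(jClosedU_act_up_iff M x b w t z a τ i ha' true false 2).2 (by decide), rfl⟩
        · exact ⟨(jClosedU_act_up_iff M x b w t z a τ i ha' true false 3).2 (by decide), rfl⟩
      · exact piPerc_midS_zero_zero_le_blockA p hty _ rfl

/-- **Cells `(a, 0, ★)` on the pin, `a ∈ {0,1,2}`**, of a middle junction `k = i₀ + 1 ≤ M`: in the regime
`t_k = u_{k+1}` (then `z_k = t_k`: the closed level `k + 1` is the bare backbone piece `b̄_k → u_{k+1}`), a package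
with target `A'^{κ,a,0}(u_k, w_k, u_{k+1}, t_k)` = the second term of (5.4) at its internal vertex (there
`δ_{z,t} = 1`, `P^0(0,0) = 1`, and the `c = 0` summand of the first term vanishes).  The single genuine letter is
the triangle bond · `{b̄ ←1→ t}` · exit line of level `k` (`t = z_k ≠ b̄_k` by (4.64)); twin of
`nonempty_jPkg_midF1_zero'` over the closed-level readings.
[cite: FitznerVanDerHofstad2017, §6.1 (6.4), "Case a = 0 and b = 0", "Case a = 1", "Case a ≥ 2" (arXiv:1506.07977v2 pp. 58–59); §5.1 (5.4) second term (p. 48); (4.58), (4.62) (p. 41); App. B (p. 75)] -/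
theorem nonempty_jPkg_closedU_pin (i i₀ : Fin (M + 1)) (hk : i₀.succ = i.castSucc) (κ : Fin d × Bool)
    (hb : (b i.castSucc).2 = (b i.castSucc).1 + stepVec κ) (hc0 : (τ i).2 = 0) (a₀ : Fin 3)
    (ha : a i.castSucc = Sum.inl a₀) {u₀ : Unit} (ha' : a i.succ = Sum.inr u₀) (hty : t i.castSucc = (b i.succ).1) :
    Nonempty (JPkg p (jctx M x b w t z a τ i.castSucc) (JFacts M x b w t z a c τ)
      (blockAiota' (Letters.perc d p) κ a₀ 0 (b i.castSucc).1 (w i.castSucc) (b i.succ).1 (t i.castSucc))) := by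
  -- degenerate parameters: the piece is empty
  by_cases hP : z i.castSucc = t i.castSucc ∧ (b i.castSucc).1 ≠ t i.castSucc ∧ (b i.castSucc).2 ≠ t i.castSucc ∧
      (a₀ = 0 → w i.castSucc = (b i.castSucc).1) ∧ (a₀ = 1 → (zdGraph d).Adj (b i.castSucc).1 (w i.castSucc))
  swap
  · refine ⟨JPkg.vacuous p _ _ (fun ω K₀ hF => hP ?_) _⟩
    have hv := hF.vac_closedU i ha'
    have hzt := (hF.t_eq_z_of_innerClass_zero i hc0).symm
    refine ⟨hzt, fun h => hv (by simp [h]), ?_, fun h0 => hF.w_eq_of_exitClass_zero i.castSucc (ha.trans (by rw [h0])),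
      fun h1 => (hF.exitClass_one i.castSucc (ha.trans (by rw [h1]))).2.2⟩
    rw [← hzt]; exact hF.v_ne_z_of_open i i₀ hk ha
  obtain ⟨hzt, hut, hvt, hw0, hw1⟩ := hP
  rw [← hty]
  refine nonempty_jPkg_closedU1_core p M x b w t z a τ c i i₀ hk κ hb ha ha'
    (event (ge 1) (b i.castSucc).2 (t i.castSucc)) (endX a₀ (b i.castSucc).1 (w i.castSucc) (t i.castSucc))
    (isFinitary_event _ _ _) (isFinitary_endX _ _ _ _) (fun ω K₀ hF => ⟨?_, ?_⟩) ?_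
  · -- entry line `b̄ → t = u′`, non-trivial
    obtain ⟨h0, -⟩ := hF.conn_closedU i ha'
    rw [event_ge]; exact mem_openConnGe_one_of_ne h0 hvt
  · -- the exit witness of level `k`: `w_k → z_k = t`
    have h5 := hF.conn_exit i i₀ hk ha
    rw [hzt] at h5
    unfold endX
    split_ifs with h0
    · rw [hw0 h0] at h5
      rw [event_comm, event_ge]
      exact mem_openConnGe_one_of_ne h5 hut
    · rw [event_comm, event_ge]
      exact mem_openConnGe_zero_of_mem h5
  · -- the letter
    refine (junF_closedU1_xb_le₃ p M x b w t z a τ i i₀ hk ha ha' _ _ _ _).trans ?_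
    unfold endX
    split_ifs with h0
    · subst h0
      rw [hw0 rfl]
      exact piPerc_midF1_zero_zero_le_blockAiota' p hb hvt.symm (fun h => hut h.symm) _
    · obtain h1 | h2 : a₀ = 1 ∨ a₀ = 2 := by
        fin_cases a₀
        · exact absurd rfl h0
        · exact Or.inl rfl
        · exact Or.inr rfl
      · subst h1
        obtain ⟨κ', hκ'⟩ := (zdGraph_adj_iff_stepVec _ _).1 (hw1 rfl)
        rw [blockAiota'_of_ne _ _ (by decide)]
        exact piPerc_midF1_one_zero_le_blockAiota p hb hκ' (fun h => hut h.symm) _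
      · subst h2
        rw [blockAiota'_of_ne _ _ (by decide)]
        exact piPerc_midF1_two_zero_le_blockAiota p hb _

end Packages

end Literature.Probability.FitznerVanDerHofstad2017

end
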